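import Summits.BirchSwinnertonDyer.Rank1Residual.AdditivePotMult.PotMultBranchPAdicGrossZagierCertIff
import Summits.BirchSwinnertonDyer.Rank1Residual.AdditivePotMult.PotMultRankOneKatoCertificateBSDOdd
import HarnessLib

/-!
# X4(M) at analytic rank ONE: the (M) CERT-version iff `BranchPAdicGrossZagierMultAt ↔ BSD(E,p)` read
# from ONE number WITHOUT Pal on the odd branch (`p ≡ 3 (mod 4)`, `p = 3` included) and from the census
# Q6 RECORD `n₀ = 1` on both branches (cell `b2b-bsdres`, team n1011, seat p17 gen 2; sequel of
# `PotMultBranchPAdicGrossZagierCertIff.lean` (lead GEN 6 R5-26 (S6)) over n1011-p12's Pal-free odd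
# constructors `PotMultRankOneKatoCertificateBSDOdd.lean` and n1011-p07's Q6 interlock — lead R5-29:
# "p12-g2's Pal-free constructors importable for `p % 4 = 3` rows")

HONEST FRAMING (cell `b2b-bsdres`, run/shared/lean/b2b/bsd-rank1-residual/, verbatim in every
file): the goal of the cell is to DELETE the COMBINATION-SHAPED residual classes of the
Birch–Swinnerton-Dyer formula for ALL analytic-rank `≤ 1` elliptic curves over `ℚ` — "full BSD
formula for every rank `≤ 1` curve in class `C`" assembled STRICTLY from published theorems — so
that the rank-`≤ 1` remainder becomes exactly the CONSTRUCTION-SHAPED classes, which are TYPED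
(missing-input `Prop`s), NOT attempted. This is not "finishing BSD". Team n1011 (RESIDUAL-MAP §I
O7-ord, (M) share: X4(M) ∧ surj(p) ∧ `r_an = 1`): prove what is provable now; shrink each hard class
to its core with data; no claim beyond stated classes; research routes; census output = EVIDENCE /
conjecture items, never a Literature fact; RESIDUAL-MAP marks change only by signed lines. X4(M) stays
CONSTRUCTION-SHAPED; §I O7 stays OPEN; nothing here is booked; no label changes. THEOREMS ONLY (NO
definition, NO Literature fact, NO `_holds`); named facts enter as HYPOTHESES (`hK` = Kato 17.4 (3)
half-eigen reading `Wuthrich2014.kato_halfEigenCharIdeal_dvd_cyclotomicPrime_of_surjective`, PUBLISHED;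
`hPal` = Pal 2012 Thm. 3.2 ONLY on the even branch `p ≡ 1 (mod 4)`, exactly where p07's Q6 interlock
carries it; `hDelM` = `Delbourgo2002.mainTheorem_potMult` only in the `∀ Dh` form; GZK `hGZK`;
modularity `hmod`, `hmodD`). The Q6 records `CensusQ6.Mult[Odd]FirstUnitIndexAt W p 1`
(census-ctyper1) and the one-number hypotheses `hone` are per-pair finite `p`-adic computations —
EVIDENCE when instantiated, never a fact. `#print axioms` standard.

COVERAGE (stated first, referee 1 proviso): per pair, `W/ℚ` globally minimal, `ClassX4M W p`,
`ρ̄_{E,p}` onto, `ord_{s=1} L(E,s) = 1`, `Dh` a (B)-datum; §1: `p ≡ 3 (mod 4)` (Pal-free, `p = 3`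
included); §2: `p ≡ 1 (mod 4)` (with `hPal`); §3: `p = 3` specialisations. NOT covered: X3♯(M).

## What (one-liners over `ClassX4M.branchPAdicGrossZagierMultAt_iff_bsdp_of_katoHalf_of_multCert`)

* §1 `…_iff_bsdp_of_katoHalf_of_norm_coeff_one_of_mod_four_eq_three` (uniform one-number shape, NO
  `hPal`), `…_of_norm_minusCoeff_one` (census-literal odd shape: twist `−p`, `Ω⁻`, `L_p⁻`), `…_of_
  firstUnitIndex_one_of_mod_four_eq_three` (the Q6 odd RECORD at index `1` IS the certificate), and the
  `∀ Dh` form with Delbourgo (M) from the record.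
* §2 `…_iff_bsdp_of_katoHalf_of_firstUnitIndex_one_of_mod_four_eq_one` (Q6 even record; `hPal` as in
  p07's `multBranchUnitCertificateAt_of_firstUnitIndex_one`).
* §3 `p = 3`: `ClassX4M.branchPAdicGrossZagierMultAt_three_iff_bsdp_of_katoHalf_of_firstUnitIndex_one`,
  `…_three_iff_bsdp_of_katoHalf_of_norm_minusCoeff_one` — on the 2 955 surj ∧ towered (M)@3 rank-one
  rows of O7-ord ∩ X4@3 (EVIDENCE, p17 split of record; KURREG K1-M list 751fcdec7c7a5348, of which
  962 are index-1-capable by n1011-r2's budget join `B(E,3) ≤ 1`, KURREG §9 A3) the typed `3`-adic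
  Gross–Zagier on the multiplicative branch of `E ⊗ χ_{−3}` and `BSD(E,3)` are ONE statement per
  Q6-certified row.

References: [Kato2004Asterisque] Thm. 17.4 (3) (p. 273); [Delbourgo2002] Thm. (A), (B) (p. 40);
[MazurTateTeitelbaum1986Invent] §I.10, §I.13–I.14; [Pal2012] Thm. 3.2; [Miller2011LMS] Def. 1.1.
-/

noncomputable section

open scoped Classical MatrixGroups ModularForm NumberField

namespace Summit.BirchSwinnertonDyer.Rank1Residual.AdditivePotMult

open CongruenceSubgroup WeierstrassCurve NumberField Literature.NumberTheory.EllipticCurves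
  Literature.NumberTheory.EllipticCurves.ModularForms
  Literature.NumberTheory.EllipticCurves.Rank1Residual
  Literature.NumberTheory.EllipticCurves.Rank1Residual.Typed
  Literature.NumberTheory.EllipticCurves.Delbourgo2002
  Literature.NumberTheory.GaloisRepresentations
  Summit.BirchSwinnertonDyer.Rank1Residual.Additive
  IsDedekindDomain

/-! ### §1 Odd branch `p ≡ 3 (mod 4)`, Pal-free (p12-g2's constructors) -/

section Odd

variable {W : WeierstrassCurve ℚ} [W.IsElliptic] [W.IsGloballyMinimal] {p : ℕ} [hp : Fact p.Prime]

/-- **X4(M) ∩ {`ρ̄_{E,p}` onto}, `p ≡ 3 (mod 4)` (`p = 3` included), `r_an = 1`, `Dh` a (B)-datum: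
`BranchPAdicGrossZagierMultAt W p Dh ↔ BSDp W p` GIVEN Kato's divisibility and ONE `p`-adic unit**
(`hone`, uniform shape) — NO `hPal`: the certificate by n1011-p12's
`multBranchUnitCertificateAt_of_norm_coeff_one_of_mod_four_eq_three` (constant term `0` from
`L(E,1) = 0`, Pal for `d < 0` is a tree theorem). [cite: Kato2004Asterisque, Thm. 17.4 (3) (p. 273)]
[cite: Delbourgo2002, Theorem (B) (p. 40)] [cite: Miller2011LMS, Def. 1.1] -/
theorem ClassX4M.branchPAdicGrossZagierMultAt_iff_bsdp_of_katoHalf_of_norm_coeff_one_of_mod_four_eq_three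
    (hK : Wuthrich2014.kato_halfEigenCharIdeal_dvd_cyclotomicPrime_of_surjective)
    (hmodD : nonempty_modularParametrizationData)
    (hGZK : rank_eq_analyticRank_of_analyticRank_le_one) (hmod : hasEntireLFunction_rat)
    (hp4 : p % 4 = 3) (hX : ClassX4M W p) (hsurj : Surj W p) (hr : W.analyticRank = 1)
    (hone : ∀ (V : WeierstrassCurve ℚ) [V.IsElliptic] [V.IsGloballyMinimal] (C : VariableChange ℚ),
      Mult V p → C • V.quadraticTwist ((-1 : ℚ) ^ (p / 2) * p) = W →
      ∀ {N : ℕ} [NeZero N] (f : CuspForm (Gamma0 N) 2), IsNewformOf V f → ∀ (ap : ℤ), cuspCoeff f p = ap →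
      ∀ ϖ : ℚ, (if Even (p / 2) then (ϖ : ℝ) * V.realPeriodRat = plusPeriod f
          else (ϖ : ℝ) * V.imaginaryPeriodRat = minusPeriod f) →
        ‖PowerSeries.coeff 1 (PowerSeries.C (ϖ : ℚ_[p]) *
            (if Even (p / 2) then padicLFunctionPlusBranchMult f (ap : ℚ_[p]) (p / 2)
              else padicLFunctionMinusBranchMult f (ap : ℚ_[p]) (p / 2)))‖ = 1)
    {Dh : PAdicHeightData W p} (hB : LeadingTermClauses W p Dh) :
    BranchPAdicGrossZagierMultAt W p Dh ↔ BSDp W p :=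
  hX.branchPAdicGrossZagierMultAt_iff_bsdp_of_katoHalf_of_multCert hK hmodD hGZK hmod hsurj hr
    (multBranchUnitCertificateAt_of_norm_coeff_one_of_mod_four_eq_three hmod hp4 hX.classX4.2.1
      (entireLFunction_one_eq_zero_of_analyticRank_ne_zero hmod (by rw [hr]; exact one_ne_zero)) hone)
    hB

/-- **Census-literal odd shape** (`p ≡ 3 (mod 4)`; twist `−p`, `Ω⁻`, `L_p⁻`): X4(M) ∩ {`ρ̄` onto},
`r_an = 1`, `Dh` a (B)-datum, Kato `hK`, and ONE unit linear coefficient of `ϖ·L_p⁻(f, a_p, ω^{(p−1)/2}, T)`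
on every multiplicative model `V` of `E ⊗ χ_{−p}` ⟹ `BranchPAdicGrossZagierMultAt W p Dh ↔ BSDp W p`.
NO `hPal` (p12-g2's `multBranchUnitCertificateAt_of_norm_minusCoeff_one`).
[cite: Kato2004Asterisque, Thm. 17.4 (3) (p. 273)] [cite: Delbourgo2002, Theorem (B) (p. 40)]
[cite: MazurTateTeitelbaum1986Invent, §I.13] [cite: Miller2011LMS, Def. 1.1] -/
theorem ClassX4M.branchPAdicGrossZagierMultAt_iff_bsdp_of_katoHalf_of_norm_minusCoeff_one
    (hK : Wuthrich2014.kato_halfEigenCharIdeal_dvd_cyclotomicPrime_of_surjective)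
    (hmodD : nonempty_modularParametrizationData)
    (hGZK : rank_eq_analyticRank_of_analyticRank_le_one) (hmod : hasEntireLFunction_rat)
    (hp4 : p % 4 = 3) (hX : ClassX4M W p) (hsurj : Surj W p) (hr : W.analyticRank = 1)
    (hone : ∀ (V : WeierstrassCurve ℚ) [V.IsElliptic] [V.IsGloballyMinimal] (C : VariableChange ℚ),
      Mult V p → C • V.quadraticTwist (-(p : ℚ)) = W →
      ∀ {N : ℕ} [NeZero N] (f : CuspForm (Gamma0 N) 2), IsNewformOf V f → ∀ (ap : ℤ), cuspCoeff f p = ap →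
      ∀ ϖ : ℚ, (ϖ : ℝ) * V.imaginaryPeriodRat = minusPeriod f →
        ‖PowerSeries.coeff 1 (PowerSeries.C (ϖ : ℚ_[p]) *
            padicLFunctionMinusBranchMult f (ap : ℚ_[p]) (p / 2))‖ = 1)
    {Dh : PAdicHeightData W p} (hB : LeadingTermClauses W p Dh) :
    BranchPAdicGrossZagierMultAt W p Dh ↔ BSDp W p :=
  hX.branchPAdicGrossZagierMultAt_iff_bsdp_of_katoHalf_of_multCert hK hmodD hGZK hmod hsurj hr
    (multBranchUnitCertificateAt_of_norm_minusCoeff_one hmod hp4 hX.classX4.2.1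
      (entireLFunction_one_eq_zero_of_analyticRank_ne_zero hmod (by rw [hr]; exact one_ne_zero)) hone)
    hB

/-- **The Q6 odd RECORD is the certificate** (`p ≡ 3 (mod 4)`): X4(M) ∩ {`ρ̄` onto}, `r_an = 1`, `Dh`
a (B)-datum, Kato `hK` and census-ctyper1's record `CensusQ6.MultOddFirstUnitIndexAt W p 1` (first
`p`-adic unit coefficient of `ϖ·L_p⁻(f, a_p, ω^{(p−1)/2}, T)` at index `1`) ⟹
`BranchPAdicGrossZagierMultAt W p Dh ↔ BSDp W p`. NO `hPal` (p12-g2's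
`multBranchUnitCertificateAt_of_firstUnitIndex_one_of_mod_four_eq_three`). The record is EVIDENCE per
pair. [cite: Kato2004Asterisque, Thm. 17.4 (3) (p. 273)] [cite: Delbourgo2002, Theorem (B) (p. 40)]
[cite: MazurTateTeitelbaum1986Invent, §I.13] [cite: Miller2011LMS, Def. 1.1] -/
theorem ClassX4M.branchPAdicGrossZagierMultAt_iff_bsdp_of_katoHalf_of_firstUnitIndex_one_of_mod_four_eq_three
    (hK : Wuthrich2014.kato_halfEigenCharIdeal_dvd_cyclotomicPrime_of_surjective)
    (hmodD : nonempty_modularParametrizationData)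
    (hGZK : rank_eq_analyticRank_of_analyticRank_le_one) (hmod : hasEntireLFunction_rat)
    (hp4 : p % 4 = 3) (hX : ClassX4M W p) (hsurj : Surj W p) (hr : W.analyticRank = 1)
    (hrec : CensusQ6.MultOddFirstUnitIndexAt W p 1)
    {Dh : PAdicHeightData W p} (hB : LeadingTermClauses W p Dh) :
    BranchPAdicGrossZagierMultAt W p Dh ↔ BSDp W p :=
  hX.branchPAdicGrossZagierMultAt_iff_bsdp_of_katoHalf_of_multCert hK hmodD hGZK hmod hsurj hr
    (multBranchUnitCertificateAt_of_firstUnitIndex_one_of_mod_four_eq_three hmod hp4 hX.classX4.2.1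
      (entireLFunction_one_eq_zero_of_analyticRank_ne_zero hmod (by rw [hr]; exact one_ne_zero)) hrec)
    hB

/-- **`∀ Dh` form from the Q6 odd record, WITH Delbourgo 2002 (M)** (`p ≡ 3 (mod 4)`): X4(M) ∩ {`ρ̄`
onto}, `r_an = 1`, Kato `hK`, the record `CensusQ6.MultOddFirstUnitIndexAt W p 1` ⟹
`BSDp W p ↔ ∀ (B)-datum Dh, BranchPAdicGrossZagierMultAt W p Dh`. NO `hPal`.
[cite: Delbourgo2002, Theorem (A), (B) (p. 40)] [cite: Kato2004Asterisque, Thm. 17.4 (3) (p. 273)]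
[cite: Miller2011LMS, Def. 1.1] -/
theorem ClassX4M.bsdp_iff_forall_branchPAdicGrossZagierMultAt_of_katoHalf_of_firstUnitIndex_one_of_mod_four_eq_three
    (hDelM : Delbourgo2002.mainTheorem_potMult)
    (hK : Wuthrich2014.kato_halfEigenCharIdeal_dvd_cyclotomicPrime_of_surjective)
    (hmodD : nonempty_modularParametrizationData)
    (hGZK : rank_eq_analyticRank_of_analyticRank_le_one) (hmod : hasEntireLFunction_rat)
    (hp4 : p % 4 = 3) (hX : ClassX4M W p) (hsurj : Surj W p) (hr : W.analyticRank = 1)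
    (hrec : CensusQ6.MultOddFirstUnitIndexAt W p 1) :
    BSDp W p ↔ ∀ Dh : PAdicHeightData W p, LeadingTermClauses W p Dh →
      BranchPAdicGrossZagierMultAt W p Dh :=
  hX.bsdp_iff_forall_branchPAdicGrossZagierMultAt_of_katoHalf_of_multCert hDelM hK hmodD hGZK hmod hsurj
    hr (multBranchUnitCertificateAt_of_firstUnitIndex_one_of_mod_four_eq_three hmod hp4 hX.classX4.2.1
      (entireLFunction_one_eq_zero_of_analyticRank_ne_zero hmod (by rw [hr]; exact one_ne_zero)) hrec)

end Odd

/-! ### §2 Even branch `p ≡ 1 (mod 4)`: the Q6 record (with `hPal`, as in p07's interlock) -/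

section Even

variable {W : WeierstrassCurve ℚ} [W.IsElliptic] [W.IsGloballyMinimal] {p : ℕ} [hp : Fact p.Prime]

/-- **The Q6 even RECORD is the certificate** (`p ≡ 1 (mod 4)`): X4(M) ∩ {`ρ̄` onto}, `r_an = 1`, `Dh`
a (B)-datum, Kato `hK`, Pal `hPal` (carried exactly as in p07's
`multBranchUnitCertificateAt_of_firstUnitIndex_one`) and census-ctyper1's record
`CensusQ6.MultFirstUnitIndexAt W p 1` ⟹ `BranchPAdicGrossZagierMultAt W p Dh ↔ BSDp W p`.
[cite: Kato2004Asterisque, Thm. 17.4 (3) (p. 273)] [cite: Pal2012, Thm. 3.2]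
[cite: Delbourgo2002, Theorem (B) (p. 40)] [cite: Miller2011LMS, Def. 1.1] -/
theorem ClassX4M.branchPAdicGrossZagierMultAt_iff_bsdp_of_katoHalf_of_firstUnitIndex_one_of_mod_four_eq_one
    (hK : Wuthrich2014.kato_halfEigenCharIdeal_dvd_cyclotomicPrime_of_surjective)
    (hPal : Pal2012.thm32_sqrt_mul_realPeriodRat_twist_eq_of_prime_one_mod_four)
    (hmodD : nonempty_modularParametrizationData)
    (hGZK : rank_eq_analyticRank_of_analyticRank_le_one) (hmod : hasEntireLFunction_rat)
    (hp4 : p % 4 = 1) (hX : ClassX4M W p) (hsurj : Surj W p) (hr : W.analyticRank = 1)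
    (hrec : CensusQ6.MultFirstUnitIndexAt W p 1)
    {Dh : PAdicHeightData W p} (hB : LeadingTermClauses W p Dh) :
    BranchPAdicGrossZagierMultAt W p Dh ↔ BSDp W p :=
  hX.branchPAdicGrossZagierMultAt_iff_bsdp_of_katoHalf_of_multCert hK hmodD hGZK hmod hsurj hr
    (multBranchUnitCertificateAt_of_firstUnitIndex_one hPal hmod hp4 hX.classX4.2.1
      (entireLFunction_one_eq_zero_of_analyticRank_ne_zero hmod (by rw [hr]; exact one_ne_zero)) hrec)
    hB

end Even

/-! ### §3 `p = 3` (the 2 955 surj ∧ towered (M)@3 rank-one rows; Pal-free) -/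

section Three

variable {W : WeierstrassCurve ℚ} [W.IsElliptic] [W.IsGloballyMinimal] [hp : Fact (Nat.Prime 3)]

/-- **X4(M)@3 ∩ {`ρ̄₃` onto}, `r_an = 1`, `Dh` a (B)-datum at `3`: Kato `hK` + the Q6 record
`CensusQ6.MultOddFirstUnitIndexAt W 3 1` (first unit coefficient of `ϖ·L₃⁻(f♭, a₃, ω, T)` at index `1`)
⟹ `BranchPAdicGrossZagierMultAt W 3 Dh ↔ BSDp W 3`.** Pal-free; EVIDENCE per row.
[cite: Kato2004Asterisque, Thm. 17.4 (3) (p. 273)] [cite: Delbourgo2002, Theorem (B) (p. 40)]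
[cite: Miller2011LMS, Def. 1.1] -/
theorem ClassX4M.branchPAdicGrossZagierMultAt_three_iff_bsdp_of_katoHalf_of_firstUnitIndex_one
    (hK : Wuthrich2014.kato_halfEigenCharIdeal_dvd_cyclotomicPrime_of_surjective)
    (hmodD : nonempty_modularParametrizationData)
    (hGZK : rank_eq_analyticRank_of_analyticRank_le_one) (hmod : hasEntireLFunction_rat)
    (hX : ClassX4M W 3) (hsurj : Surj W 3) (hr : W.analyticRank = 1)
    (hrec : CensusQ6.MultOddFirstUnitIndexAt W 3 1)
    {Dh : PAdicHeightData W 3} (hB : LeadingTermClauses W 3 Dh) :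
    BranchPAdicGrossZagierMultAt W 3 Dh ↔ BSDp W 3 :=
  hX.branchPAdicGrossZagierMultAt_iff_bsdp_of_katoHalf_of_firstUnitIndex_one_of_mod_four_eq_three hK
    hmodD hGZK hmod (by decide) hsurj hr hrec hB

/-- **X4(M)@3 ∩ {`ρ̄₃` onto}, `r_an = 1`, one-number form**: Kato `hK` + ONE `3`-adic unit linear
coefficient on every multiplicative model of `E ⊗ χ_{−3}` (census-literal odd shape) ⟹
`BranchPAdicGrossZagierMultAt W 3 Dh ↔ BSDp W 3`. Pal-free. [cite: Kato2004Asterisque, Thm. 17.4 (3) (p. 273)]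
[cite: Delbourgo2002, Theorem (B) (p. 40)] [cite: Miller2011LMS, Def. 1.1] -/
theorem ClassX4M.branchPAdicGrossZagierMultAt_three_iff_bsdp_of_katoHalf_of_norm_minusCoeff_one
    (hK : Wuthrich2014.kato_halfEigenCharIdeal_dvd_cyclotomicPrime_of_surjective)
    (hmodD : nonempty_modularParametrizationData)
    (hGZK : rank_eq_analyticRank_of_analyticRank_le_one) (hmod : hasEntireLFunction_rat)
    (hX : ClassX4M W 3) (hsurj : Surj W 3) (hr : W.analyticRank = 1)
    (hone : ∀ (V : WeierstrassCurve ℚ) [V.IsElliptic] [V.IsGloballyMinimal] (C : VariableChange ℚ),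
      Mult V 3 → C • V.quadraticTwist (-(3 : ℚ)) = W →
      ∀ {N : ℕ} [NeZero N] (f : CuspForm (Gamma0 N) 2), IsNewformOf V f → ∀ (ap : ℤ), cuspCoeff f 3 = ap →
      ∀ ϖ : ℚ, (ϖ : ℝ) * V.imaginaryPeriodRat = minusPeriod f →
        ‖PowerSeries.coeff 1 (PowerSeries.C (ϖ : ℚ_[3]) *
            padicLFunctionMinusBranchMult f (ap : ℚ_[3]) (3 / 2))‖ = 1)
    {Dh : PAdicHeightData W 3} (hB : LeadingTermClauses W 3 Dh) :
    BranchPAdicGrossZagierMultAt W 3 Dh ↔ BSDp W 3 :=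
  hX.branchPAdicGrossZagierMultAt_iff_bsdp_of_katoHalf_of_norm_minusCoeff_one hK hmodD hGZK hmod
    (by decide) hsurj hr (by exact_mod_cast hone) hB

/-- **X4(M)@3, `∀ Dh` form from the Q6 record WITH Delbourgo 2002 (M)**: Kato `hK` + the record
`CensusQ6.MultOddFirstUnitIndexAt W 3 1` ⟹ `BSDp W 3 ↔ ∀ (B)-datum Dh, BranchPAdicGrossZagierMultAt W 3 Dh`.
[cite: Delbourgo2002, Theorem (A), (B) (p. 40)] [cite: Kato2004Asterisque, Thm. 17.4 (3) (p. 273)]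
[cite: Miller2011LMS, Def. 1.1] -/
theorem ClassX4M.bsdp_three_iff_forall_branchPAdicGrossZagierMultAt_of_katoHalf_of_firstUnitIndex_one
    (hDelM : Delbourgo2002.mainTheorem_potMult)
    (hK : Wuthrich2014.kato_halfEigenCharIdeal_dvd_cyclotomicPrime_of_surjective)
    (hmodD : nonempty_modularParametrizationData)
    (hGZK : rank_eq_analyticRank_of_analyticRank_le_one) (hmod : hasEntireLFunction_rat)
    (hX : ClassX4M W 3) (hsurj : Surj W 3) (hr : W.analyticRank = 1)
    (hrec : CensusQ6.MultOddFirstUnitIndexAt W 3 1) :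
    BSDp W 3 ↔ ∀ Dh : PAdicHeightData W 3, LeadingTermClauses W 3 Dh →
      BranchPAdicGrossZagierMultAt W 3 Dh :=
  hX.bsdp_iff_forall_branchPAdicGrossZagierMultAt_of_katoHalf_of_firstUnitIndex_one_of_mod_four_eq_three
    hDelM hK hmodD hGZK hmod (by decide) hsurj hr hrec

end Three

end Summit.BirchSwinnertonDyer.Rank1Residual.AdditivePotMult

end
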